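import Summits.QuantumFields.YangMills.Theorems.SwapTwistDeficitFlatSheetBox
import HarnessLib

/-!
# The `x`-Polyakov holonomy through the origin of `(ℤ/L)³` and its distance to the centre — a physical, Lipschitz functional
# separating the identity configuration from the flat sheet configuration

Second geometry module for the FIXED-LATTICE rungs of the trace-door cruxes K2a `ThermalTraceWindow.SubFemtoFirstLevel`
(stmt-QuantumFields-28291) and `SwapTwistDeficit.TwistDeficit` (stmt-QuantumFields-23317) of seat ym-idea-4 (companion of
`…SwapTwistDeficitFlatSheetBox.lean`).  For `U : GaugeConfig 3 L SU2`:

* (objects of `…SwapTwistDeficitFlatSheetDefs`) `lineEdge L j = (j·e₀, 0)`, `polyXAux U n = U(ℓ₀)U(ℓ₁)⋯U(ℓ_{n−1})`, the `x`-POLYAKOV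
  HOLONOMY `polyX U = polyXAux U L` and `polDist U = vacDist (polyX U) ∈ [0, 2]`, its Hilbert–Schmidt distance to the centre `{±1}`;
* `polyXAux_gaugeTransform` (telescoping: `P_n(U^g) = g(0) P_n(U) g(n·e₀)⁻¹`), hence `polDist (U^g) = polDist U` (`vacDist_conj`, `L·e₀ = 0`);
  `polyXAux_twist_zero` (`P_n(twist₀^z U) = z·P_n(U)` for `1 ≤ n ≤ L`: exactly the link at the origin lies on the sheet) and `polyX_twist_of_ne`,
  hence `polDist` is twist invariant (`vacDist_center_mul`); continuity ∕ measurability; so every `h ∘ polDist` with `h` continuous and bounded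
  is a PHYSICAL zero-flux test function (`isPhys_comp_polDist`);
* the Lipschitz bound `|polDist U − polDist V| ≤ Σ_{j<L} ‖U_{ℓ_j} − V_{ℓ_j}‖_F ≤ L·r`, and its contrapositive `exists_far_lineEdge`;
* values: `polDist 1 = 0`, `polDist (sheetCfg L) = 2`, `polDist (S · sheetCfg L) = 0` for the axis swap `S = configPerm (swap 0 1)`, and the box
  estimates `polDist U ≥ 2 − L r`, `polDist (S U) ≤ L r` on `A_r(sheetCfg L)`.

HONEST FRAMING: fixed-lattice bookkeeping for BC5 witnesses of DRAFT lines onto a RECORD rung; no RG content; nothing about infinite volume,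
the continuum or the Clay gap.  No `sorry`, no new axiom, no new definition.
References: [cite: Luscher1983, §2] (Polyakov loops ∕ torons and centre twists on the torus); [cite: tHooft1979] (electric flux).
-/

set_option autoImplicit false

noncomputable section

open MeasureTheory Filter Topology Real
open scoped Matrix ComplexConjugate BigOperators
open Literature.MathematicalPhysics.QuantumFieldTheory
open Literature.MathematicalPhysics.QuantumLattice

namespace Summit.QuantumFields.YangMills.Theorems.FemtoTransferGap

namespace FlatSheet

variable {L : ℕ}

/-! ## §1 The holonomy along the `x`-axis -/

/-- `P_0 = 1`. [folklore] -/
@[simp] theorem polyXAux_zero (U : GaugeConfig 3 L SU2) : polyXAux U 0 = 1 := rfl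

/-- `P_{n+1} = P_n · U(ℓ_n)`. [folklore] -/
theorem polyXAux_succ (U : GaugeConfig 3 L SU2) (n : ℕ) : polyXAux U (n + 1) = polyXAux U n * U (lineEdge L n) := rfl

/-- `P_n` only depends on the links of the axis. [folklore] -/
theorem polyXAux_congr {U V : GaugeConfig 3 L SU2} (h : ∀ j, U (lineEdge L j) = V (lineEdge L j)) (n : ℕ) :
    polyXAux U n = polyXAux V n := by
  induction n with
  | zero => rfl
  | succ n ih => rw [polyXAux_succ, polyXAux_succ, ih, h n]

/-- `P_n(1) = 1`. [folklore] -/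
theorem polyXAux_one (n : ℕ) : polyXAux (1 : GaugeConfig 3 L SU2) n = 1 := by
  induction n with
  | zero => rfl
  | succ n ih => rw [polyXAux_succ, ih, Pi.one_apply, one_mul]

/-- `polDist 1 = 0`. [folklore] -/
theorem polDist_one : polDist (1 : GaugeConfig 3 L SU2) = 0 := by
  rw [polDist, polyX, polyXAux_one, vacDist_one]

/-- `0 ≤ polDist`. [folklore] -/
theorem polDist_nonneg (U : GaugeConfig 3 L SU2) : 0 ≤ polDist U := vacDist_nonneg _

/-- `polDist ≤ 2` (one of `‖P ∓ 1‖_F²` is `≤ 4` by the parallelogram law `‖P−1‖² + ‖P+1‖² = 8`). [folklore] -/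
theorem polDist_le_two (U : GaugeConfig 3 L SU2) : polDist U ≤ 2 := by
  unfold polDist vacDist
  set a := frobNorm (((polyX U : SU2) : Matrix (Fin 2) (Fin 2) ℂ) - 1)
  set b := frobNorm (((polyX U : SU2) : Matrix (Fin 2) (Fin 2) ℂ) + 1)
  have h8 : b ^ 2 = 8 - a ^ 2 := frobNorm_add_one_sq_eq (polyX U)
  have ha : 0 ≤ a := frobNorm_nonneg _
  have hb : 0 ≤ b := frobNorm_nonneg _
  rcases le_or_gt a 2 with h | h
  · exact (min_le_left _ _).trans h
  · have hb2 : b ≤ 2 := by nlinarith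
    exact (min_le_right _ _).trans hb2

/-! ## §2 Gauge and twist invariance; continuity; physical test functions through `polDist` -/

/-- The end point of the first `n` links: `ℓ_n` starts at `n·e₀`, and `(n·e₀).shift 0 = (n+1)·e₀`. [folklore] -/
theorem lineEdge_shift (L : ℕ) (n : ℕ) : (lineEdge L n).1.shift (lineEdge L n).2 = (lineEdge L (n + 1)).1 := by
  simp only [lineEdge, Site.shift, ← Pi.single_add, Nat.cast_succ]

/-- **Telescoping**: `P_n(U^g) = g(0) · P_n(U) · g(n·e₀)⁻¹`. [folklore] -/
theorem polyXAux_gaugeTransform (g : Site 3 L → SU2) (U : GaugeConfig 3 L SU2) (n : ℕ) :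
    polyXAux (gaugeTransform g U) n = g 0 * polyXAux U n * (g (lineEdge L n).1)⁻¹ := by
  induction n with
  | zero =>
    simp only [polyXAux_zero, lineEdge, Nat.cast_zero, Pi.single_zero, mul_one, mul_inv_cancel]
  | succ n ih =>
    rw [polyXAux_succ, polyXAux_succ, ih]
    simp only [gaugeTransform, lineEdge_shift]
    group

/-- `P(U^g) = g(0) P(U) g(0)⁻¹` (the axis closes up: `L·e₀ = 0`). [cite: Luscher1983, §2] -/
theorem polyX_gaugeTransform (g : Site 3 L → SU2) (U : GaugeConfig 3 L SU2) :
    polyX (gaugeTransform g U) = g 0 * polyX U * (g 0)⁻¹ := by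
  rw [polyX, polyX, polyXAux_gaugeTransform]
  simp only [lineEdge, ZMod.natCast_self, Pi.single_zero]

/-- **Gauge invariance** of `polDist`. [cite: Luscher1983, §2] -/
theorem polDist_gaugeTransform (g : Site 3 L → SU2) (U : GaugeConfig 3 L SU2) : polDist (gaugeTransform g U) = polDist U := by
  rw [polDist, polDist, polyX_gaugeTransform, vacDist_conj]

/-- A twist through a plane `x_k = 0` with `k ≠ 0` does not touch the `x`-axis. [folklore] -/
theorem polyX_twist_of_ne {k : Fin 3} (hk : k ≠ 0) (z : SU2) (U : GaugeConfig 3 L SU2) : polyX (twist k z U) = polyX U := by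
  refine polyXAux_congr (fun j => ?_) L
  simp only [twist, lineEdge]
  rw [if_neg]
  rintro ⟨h0, -⟩
  exact hk h0.symm

/-- For `0 < j < L` the site `j·e₀` is off the plane `x₀ = 0`. [folklore] -/
theorem lineEdge_fst_apply_zero_ne {j : ℕ} (hj0 : 0 < j) (hjL : j < L) : (lineEdge L j).1 0 ≠ 0 := by
  simp only [lineEdge, Pi.single_eq_same]
  rw [Ne, ZMod.natCast_eq_zero_iff]
  exact fun h => absurd (Nat.le_of_dvd hj0 h) (not_le.2 hjL)

/-- **The twist through `x₀ = 0` multiplies the holonomy**: `P_n(twist₀^z U) = z · P_n(U)` for `1 ≤ n ≤ L` (for ANY `z`, central or not: exactly the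
link at the origin lies on the sheet). [cite: tHooft1979] -/
theorem polyXAux_twist_zero (z : SU2) (U : GaugeConfig 3 L SU2) {n : ℕ} (hn1 : 1 ≤ n) (hnL : n ≤ L) :
    polyXAux (twist 0 z U) n = z * polyXAux U n := by
  induction n with
  | zero => exact absurd hn1 (by norm_num)
  | succ n ih =>
    rw [polyXAux_succ, polyXAux_succ]
    rcases Nat.eq_zero_or_pos n with rfl | hn
    · simp only [polyXAux_zero, one_mul, twist, lineEdge, Nat.cast_zero, Pi.single_zero, Pi.zero_apply, and_self, if_true]
    · rw [ih hn (Nat.le_of_succ_le hnL), mul_assoc]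
      congr 1
      simp only [twist]
      rw [if_neg]
      rintro ⟨-, h⟩
      exact lineEdge_fst_apply_zero_ne hn (Nat.lt_of_succ_le hnL) h

/-- `P(twist₀^z U) = z · P(U)` (`L ≥ 1`). [cite: tHooft1979] -/
theorem polyX_twist_zero [NeZero L] (z : SU2) (U : GaugeConfig 3 L SU2) : polyX (twist 0 z U) = z * polyX U :=
  polyXAux_twist_zero z U (Nat.one_le_iff_ne_zero.2 (NeZero.ne L)) le_rfl

/-- **Twist invariance** of `polDist` under CENTRE twists. [cite: tHooft1979] -/
theorem polDist_twist [NeZero L] (k : Fin 3) {z : SU2} (hz : z ∈ Subgroup.center SU2) (U : GaugeConfig 3 L SU2) :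
    polDist (twist k z U) = polDist U := by
  unfold polDist
  by_cases hk : k = 0
  · subst hk; rw [polyX_twist_zero, vacDist_center_mul hz]
  · rw [polyX_twist_of_ne hk]

/-- `U ↦ P_n(U)` is continuous. [folklore] -/
theorem continuous_polyXAux (n : ℕ) : Continuous fun U : GaugeConfig 3 L SU2 => polyXAux U n := by
  induction n with
  | zero => exact continuous_const
  | succ n ih => exact ih.mul (continuous_apply _)

/-- `polDist` is continuous. [folklore] -/
theorem continuous_polDist : Continuous (polDist (L := L)) :=
  continuous_vacDist.comp (continuous_polyXAux L)

/-- `polDist` is measurable. [folklore] -/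
theorem measurable_polDist [NeZero L] : Measurable (polDist (L := L)) := by
  haveI := secondCountableTopology_su2
  exact continuous_polDist.measurable

/-- ★ **Physical test functions through the holonomy**: for continuous `h : ℝ → ℝ` with `|h| ≤ C`, `U ↦ h (polDist U)` is a physical
zero-flux test function (measurable, bounded, gauge invariant, centre-twist invariant). [cite: Luscher1983, §2] -/
theorem isPhys_comp_polDist [NeZero L] {h : ℝ → ℝ} (hc : Continuous h) {C : ℝ} (hC : ∀ t, |h t| ≤ C) :
    IsPhys (fun U : GaugeConfig 3 L SU2 => h (polDist U)) where
  measurable := by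
    haveI := secondCountableTopology_su2
    exact (hc.comp continuous_polDist).measurable
  bounded := ⟨C, fun U => hC _⟩
  gaugeInv := fun g U => by simp only [polDist_gaugeTransform]
  zeroFlux := fun k z hz U => by simp only [polDist_twist k hz]

/-! ## §3 The Lipschitz bound and the far-link alternative -/

/-- `‖P_n(U) − P_n(V)‖_F ≤ Σ_{j<n} ‖U_{ℓ_j} − V_{ℓ_j}‖_F`. [folklore] -/
theorem frobNorm_polyXAux_sub_le (U V : GaugeConfig 3 L SU2) (n : ℕ) :
    frobNorm (((polyXAux U n : SU2) : Matrix (Fin 2) (Fin 2) ℂ) - ((polyXAux V n : SU2) : Matrix (Fin 2) (Fin 2) ℂ)) ≤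
      ∑ j ∈ Finset.range n, frobNorm ((U (lineEdge L j) : Matrix (Fin 2) (Fin 2) ℂ) - (V (lineEdge L j) : Matrix (Fin 2) (Fin 2) ℂ)) := by
  induction n with
  | zero => simp [frobNorm_zero]
  | succ n ih =>
    rw [polyXAux_succ, polyXAux_succ, Finset.sum_range_succ]
    exact (frobNorm_mul_sub_mul_le _ _ _ _).trans (add_le_add ih le_rfl)

/-- **Lipschitz bound**: `|polDist U − polDist V| ≤ Σ_{j<L} ‖U_{ℓ_j} − V_{ℓ_j}‖_F`. [folklore] -/
theorem abs_polDist_sub_le (U V : GaugeConfig 3 L SU2) :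
    |polDist U - polDist V| ≤
      ∑ j ∈ Finset.range L, frobNorm ((U (lineEdge L j) : Matrix (Fin 2) (Fin 2) ℂ) - (V (lineEdge L j) : Matrix (Fin 2) (Fin 2) ℂ)) :=
  (abs_vacDist_sub_le _ _).trans (frobNorm_polyXAux_sub_le U V L)

/-- Uniform version: `‖U_{ℓ_j} − V_{ℓ_j}‖_F ≤ r` for all `j < L` gives `|polDist U − polDist V| ≤ L·r`. [folklore] -/
theorem abs_polDist_sub_le_of_forall (U V : GaugeConfig 3 L SU2) {r : ℝ}
    (h : ∀ j, j < L → frobNorm ((U (lineEdge L j) : Matrix (Fin 2) (Fin 2) ℂ) - (V (lineEdge L j) : Matrix (Fin 2) (Fin 2) ℂ)) ≤ r) :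
    |polDist U - polDist V| ≤ L * r := by
  refine (abs_polDist_sub_le U V).trans ?_
  calc ∑ j ∈ Finset.range L, frobNorm ((U (lineEdge L j) : Matrix (Fin 2) (Fin 2) ℂ) - (V (lineEdge L j) : Matrix (Fin 2) (Fin 2) ℂ))
      ≤ ∑ _j ∈ Finset.range L, r := Finset.sum_le_sum fun j hj => h j (Finset.mem_range.1 hj)
    _ = L * r := by rw [Finset.sum_const, Finset.card_range, nsmul_eq_mul]

/-- **Far-link alternative**: if `|polDist U − polDist V| > L·r` then some axis link has `‖U_{ℓ_j} − V_{ℓ_j}‖_F > r`. [folklore] -/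
theorem exists_far_lineEdge (U V : GaugeConfig 3 L SU2) {r : ℝ} (h : (L : ℝ) * r < |polDist U - polDist V|) :
    ∃ j, j < L ∧ r < frobNorm ((U (lineEdge L j) : Matrix (Fin 2) (Fin 2) ℂ) - (V (lineEdge L j) : Matrix (Fin 2) (Fin 2) ℂ)) := by
  by_contra hne
  have hne' : ∀ j, j < L →
      frobNorm ((U (lineEdge L j) : Matrix (Fin 2) (Fin 2) ℂ) - (V (lineEdge L j) : Matrix (Fin 2) (Fin 2) ℂ)) ≤ r :=
    fun j hj => not_lt.1 fun hlt => hne ⟨j, hj, hlt⟩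
  exact absurd (abs_polDist_sub_le_of_forall U V hne') (not_le.2 h)

/-! ## §4 Values at the reference configurations and on the sheet box -/

/-- `P(sheetCfg L) = diag(i,−i)` (`sheetCfg = twist₀^{diag(i,−i)} 1`). [cite: Luscher1983, §2] -/
theorem polyX_sheetCfg [NeZero L] : polyX (sheetCfg L) = diagSU2 (π / 2) := by
  rw [sheetCfg, polyX_twist_zero, polyX, polyXAux_one, mul_one]

/-- `polDist (sheetCfg L) = 2`. [folklore] -/
theorem polDist_sheetCfg [NeZero L] : polDist (sheetCfg L) = 2 := by
  rw [polDist, polyX_sheetCfg, vacDist_diagSU2_half_pi]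

/-- The swapped sheet has trivial `x`-links along the axis: `(S·sheetCfg L)(ℓ_j) = 1`. [folklore] -/
theorem configPerm_swap_sheetCfg_lineEdge (j : ℕ) :
    configPerm (Equiv.swap (0 : Fin 3) 1) (sheetCfg L) (lineEdge L j) = 1 := by
  rw [configPerm_apply, sheetCfg_apply, if_neg]
  simp only [lineEdge, Equiv.symm_swap, Equiv.swap_apply_left, Fin.one_eq_zero_iff, OfNat.ofNat_ne_one, false_and,
    not_false_eq_true]

/-- `polDist (S·sheetCfg L) = 0` for the axis swap `S = configPerm (swap 0 1)`. [folklore] -/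
theorem polDist_configPerm_swap_sheetCfg : polDist (configPerm (Equiv.swap (0 : Fin 3) 1) (sheetCfg L)) = 0 := by
  have h : polyX (configPerm (Equiv.swap (0 : Fin 3) 1) (sheetCfg L)) = polyX (1 : GaugeConfig 3 L SU2) :=
    polyXAux_congr (fun j => by rw [configPerm_swap_sheetCfg_lineEdge, Pi.one_apply]) L
  rw [polDist, h, ← polDist, polDist_one]

/-- On the box `A_r(sheetCfg L)`: `polDist U ≥ 2 − L·r`. [folklore] -/
theorem polDist_ge_of_near_sheet [NeZero L] {U : GaugeConfig 3 L SU2} {r : ℝ}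
    (hU : ∀ e, frobNorm ((U e : Matrix (Fin 2) (Fin 2) ℂ) - (sheetCfg L e : Matrix (Fin 2) (Fin 2) ℂ)) ≤ r) :
    2 - L * r ≤ polDist U := by
  have h := abs_polDist_sub_le_of_forall U (sheetCfg L) (r := r) fun j _ => hU _
  rw [polDist_sheetCfg] at h
  have := (abs_sub_le_iff.1 h).2
  linarith

/-- On the box `A_r(sheetCfg L)`: `polDist (S U) ≤ L·r` (`S` permutes the links, so `S U ∈ A_r(S·sheetCfg L)`). [folklore] -/
theorem polDist_configPerm_le_of_near_sheet {U : GaugeConfig 3 L SU2} {r : ℝ}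
    (hU : ∀ e, frobNorm ((U e : Matrix (Fin 2) (Fin 2) ℂ) - (sheetCfg L e : Matrix (Fin 2) (Fin 2) ℂ)) ≤ r) :
    polDist (configPerm (Equiv.swap (0 : Fin 3) 1) U) ≤ L * r := by
  have h := abs_polDist_sub_le_of_forall (configPerm (Equiv.swap (0 : Fin 3) 1) U)
    (configPerm (Equiv.swap (0 : Fin 3) 1) (sheetCfg L)) (r := r) fun j _ => by
      simp only [configPerm_apply]; exact hU _
  rw [polDist_configPerm_swap_sheetCfg, sub_zero] at h
  exact (le_abs_self _).trans h

end FlatSheet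

end Summit.QuantumFields.YangMills.Theorems.FemtoTransferGap

end
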